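import Summits.ABC.IUTFork.Joshi.ATS4TateDivisorsOverDeformation

/-!
# [J-IV] (arXiv:2403.10430v2) §4.5 over the ARITHMETIC MODEL of Joshi's [J-2½] signature: the integer data of §4.2/§4.4
# DISCHARGED from Mathlib, and Prop. 4.5.12 decided BY NAME on both readings at one datum of record

Proof-side companion of `Joshi/ATS4TateDivisorsOverDeformation.lean` (abc-iut cell, branch E, rung LADDER-ABC:A2.E; seat
abc-iut-E-t27, slot T-27). **No side is taken** on [IUTchIII] Cor. 3.12, on Joshi's claims, or on Mochizuki's reports on them;
a model exhibits satisfiability, nothing more; TYPED ≠ PROVED ≠ ENDORSED.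

The companion typed `TateParamsZ D` — Tate parameters over a [J-2½] deformation datum together with the integer data of [J-IV]
§4.2/§4.4 (`[L:ℚ]`, `ord_v`, uniformisers, «log v») and ONE hypothesis field, the normalisation `log|x|_v = −ord_v(x)·log v` of the
Artin–Whaples absolute value at the places of the semistable support. THIS FILE discharges that field at seat E-t48's arithmetic model
`ATS2h.NumberFieldModel.model F` of the signature (ANY number field `F`, all places, `L_v = (F, |−|_v)`, Mathlib's finite places):
* `ordLoc F v : L_v^* → ℤ` — E-t48's normalised valuation `NumberFieldModel.ord` (uniformisers ↦ `+1`) transported to `L_v^*`;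
  `toAdd_ordLoc_inr`: at a finite place `w`, `ord_w(x) = −log_{ℤᵐ⁰}(val_w x)` (Mathlib's multiplicative valuation, inverted);
* **`log_absLoc_inr`** (the discharge): `log|x|_w = −ord_w(x)·log N(𝔭_w)` for every `x ∈ L_w^*`, from Mathlib's
  `NumberField.FinitePlace.norm_embedding'` (`|x|_w = N(𝔭_w)^{−ord_w x}`) — [folklore];
* `modelTateParamsZ F w x hx` — the datum with ONE bad place `w`, Tate parameter `x ∈ F^*` at `w`, `[F:ℚ]`, `ordLoc`, a Mathlib
  uniformiser (`valuation_exists_uniformizer`), «log v» `= log N(𝔭_v)`; all `TateParamsZ` fields PROVED (no hypothesis left);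
* **both readings of [J-IV] Prop. 4.5.12 decided BY NAME at this datum, for every Kummer target `(H, kum)`:**
  `model_not_tateDegreeNonConstant_datumNor` — the NORMALISED reading («`arith(L)^nor_z`», as printed p.44 l.24–26) of E-t27's
  `TateIdeleDatum.TateDegreeNonConstant` FAILS; `model_tateDegreeNonConstant_datumRaw` — the RAW reading HOLDS as soon as
  `|x|_w ≠ 1` (the arithmeticoids `y_0`, `y_1 = ϕ(y_0)` have `α_w = 1`, `p_w⁻¹`); `model_prop4512_both_horns` packages the two with
  Mathlib's witness of an `x` with `|x|_w ≠ 1`.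
LOCATED (as in the companion; no side): on Joshi's own carriers the `z`-dependence of `log(TI_z)` is exactly the un-normalised
coordinate `α` of [J-2½] (5.3.3) and vanishes under the normalisation Prop. 4.5.12 prescribes; a `z`-dependent Tate class not of
the form `ι_z(q_v)` ([J-IV] Thm. 3.3.1 (2)–(4), Prop. 4.5.11's all-isomorphism collation) is the attach point. No `sorry`, axiom,
instance, notation, or `Prop` fact; the three `def`s are model data. [folklore] for the number theory; [claim: Joshi2024ATS4,
status: disputed] tags only the provenance of the [J-IV] readings.
-/

noncomputable section
namespace Summit.ABC.IUTFork.Joshi.ATS4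
open ATS2h NumberField IsDedekindDomain

section Model

variable (F : Type) [Field F] [NumberField F]

/-- `ord_v : L_v^* → ℤ` on the model's `L_v = (F, |−|_v)`: E-t48's `NumberFieldModel.ord` (normalised, uniformisers ↦ `+1`,
trivial at infinite places) transported along `WithAbs.equiv`. [folklore] -/
def ordLoc (v : NumberFieldModel.Place F) : (NumberFieldModel.Loc F v)ˣ →* Multiplicative ℤ :=
  (NumberFieldModel.ord F v).comp (Units.map (WithAbs.equiv (NumberFieldModel.absval F v)).toRingHom.toMonoidHom)

/-- At a finite place `w`: `ord_w(x) = −log_{ℤᵐ⁰}(val_w(x))`, Mathlib's multiplicative `w`-adic valuation inverted (so that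
uniformisers have `ord_w = +1`). [folklore] -/
theorem toAdd_ordLoc_inr (w : FinitePlace F) (x : (NumberFieldModel.Loc F (Sum.inr w))ˣ) :
    Multiplicative.toAdd (ordLoc F (Sum.inr w) x) =
      -WithZero.log (w.maximalIdeal.valuation F
        (WithAbs.equiv (NumberFieldModel.absval F (Sum.inr w)) (x : NumberFieldModel.Loc F (Sum.inr w)))) := by
  show Multiplicative.toAdd ((WithZero.unitsWithZeroEquiv (Units.map (w.maximalIdeal.valuation F).toMonoidHom
    (Units.map (WithAbs.equiv (NumberFieldModel.absval F (Sum.inr w))).toRingHom.toMonoidHom x)))⁻¹) = _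
  rw [toAdd_inv]
  exact congrArg Neg.neg (WithZero.logEquiv_apply _)

/-- **The normalisation of `|−|_w` at a finite place, DISCHARGED from Mathlib:** `log|x|_w = −ord_w(x)·log N(𝔭_w)` for
`x ∈ L_w^*` (`|x|_w = N(𝔭_w)^{−ord_w(x)}`, Mathlib `NumberField.FinitePlace.norm_embedding'`). This is the one hypothesis
field `log_absLv_eq` of `TateParamsZ`, here a theorem. [folklore] -/
theorem log_absLoc_inr (w : FinitePlace F) (x : (NumberFieldModel.Loc F (Sum.inr w))ˣ) :
    Real.log (NumberFieldModel.absLoc F (Sum.inr w) (x : NumberFieldModel.Loc F (Sum.inr w))) =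
      -((Multiplicative.toAdd (ordLoc F (Sum.inr w) x) : ℤ) : ℝ) *
        Real.log (Ideal.absNorm w.maximalIdeal.asIdeal : ℝ) := by
  set y : F := WithAbs.equiv (NumberFieldModel.absval F (Sum.inr w)) (x : NumberFieldModel.Loc F (Sum.inr w)) with hy
  have hy0 : y ≠ 0 := by simp [hy]
  have hval : w.maximalIdeal.valuation F y ≠ 0 := (Valuation.ne_zero_iff _).2 hy0
  have h1 : NumberFieldModel.absLoc F (Sum.inr w) (x : NumberFieldModel.Loc F (Sum.inr w)) = w y := by
    show ‖(x : NumberFieldModel.Loc F (Sum.inr w))‖ ^ 1 = w y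
    rw [pow_one]
    rfl
  have h2 : (w y : ℝ) = (Ideal.absNorm w.maximalIdeal.asIdeal : ℝ) ^ WithZero.log (w.maximalIdeal.valuation F y) := by
    rw [← NumberField.FinitePlace.norm_embedding_eq w y, NumberField.FinitePlace.norm_embedding',
      WithZeroMulInt.toNNReal_neg_apply _ hval, NNReal.coe_zpow, NNReal.coe_natCast]
    congr 1
    conv_rhs => rw [← WithZero.coe_unzero hval]
    rfl
  rw [h1, h2, Real.log_zpow, toAdd_ordLoc_inr]
  push_cast
  ring

/-- A uniformiser of `F` at the finite place `w` (Mathlib `valuation_exists_uniformizer`: valuation `exp(−1)`). [folklore] -/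
def unifElt (w : FinitePlace F) : F := Classical.choose (w.maximalIdeal.valuation_exists_uniformizer F)

/-- The chosen uniformiser has `w`-adic valuation `exp(−1)`. [folklore] -/
theorem valuation_unifElt (w : FinitePlace F) : w.maximalIdeal.valuation F (unifElt F w) = WithZero.exp (-1 : ℤ) :=
  Classical.choose_spec (w.maximalIdeal.valuation_exists_uniformizer F)

/-- The chosen uniformiser is non-zero. [folklore] -/
theorem unifElt_ne_zero (w : FinitePlace F) : unifElt F w ≠ 0 := by
  intro h
  have := valuation_unifElt F w
  rw [h, map_zero] at this
  exact WithZero.exp_ne_zero this.symm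

/-- `toLoc v x ≠ 0` for `x ≠ 0` (the identity on elements). [folklore] -/
theorem toLoc_ne_zero (v : NumberFieldModel.Place F) {x : F} (hx : x ≠ 0) : NumberFieldModel.toLoc F v x ≠ 0 := by
  simpa [NumberFieldModel.toLoc] using hx

/-- Uniformisers `π_v ∈ L_v^*` at every place of the model: the chosen one at a finite place, `1` at an infinite place.
[folklore] -/
def unifLoc : (v : NumberFieldModel.Place F) → (NumberFieldModel.Loc F v)ˣ
  | Sum.inl _ => 1
  | Sum.inr w => Units.mk0 (NumberFieldModel.toLoc F (Sum.inr w) (unifElt F w)) (toLoc_ne_zero F _ (unifElt_ne_zero F w))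

/-- `ord_w(π_w) = +1` for the chosen uniformiser. [folklore] -/
theorem ordLoc_unifLoc_inr (w : FinitePlace F) : ordLoc F (Sum.inr w) (unifLoc F (Sum.inr w)) = Multiplicative.ofAdd 1 := by
  rw [← ofAdd_toAdd (ordLoc F (Sum.inr w) (unifLoc F (Sum.inr w))), toAdd_ordLoc_inr]
  congr 1
  show -WithZero.log (w.maximalIdeal.valuation F ((WithAbs.equiv (NumberFieldModel.absval F (Sum.inr w)))
    ((WithAbs.equiv (NumberFieldModel.absval F (Sum.inr w))).symm (unifElt F w)))) = 1
  rw [RingEquiv.apply_symm_apply, valuation_unifElt, WithZero.log_exp, neg_neg]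

/-- «log v» at the places of the model: `log N(𝔭_v)` at a finite place ([J-IV] §4.2 p.39 l.6–10 «the logarithm of the cardinality
of the residue field»), `0` at an infinite place (unused). [folklore] -/
def logNLoc : NumberFieldModel.Place F → ℝ
  | Sum.inl _ => 0
  | Sum.inr w => Real.log (Ideal.absNorm w.maximalIdeal.asIdeal : ℝ)

/-- `log N(𝔭_w) ≠ 0` (`N(𝔭_w) > 1`). [folklore] -/
theorem logNLoc_inr_ne_zero (w : FinitePlace F) : logNLoc F (Sum.inr w) ≠ 0 := by
  have h1 : (1 : ℝ) < (Ideal.absNorm w.maximalIdeal.asIdeal : ℝ) := by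
    exact_mod_cast NumberField.HeightOneSpectrum.one_lt_absNorm w.maximalIdeal
  exact (Real.log_pos h1).ne'

/-- **The [J-IV] §4.2/§4.4/§4.5 datum at the arithmetic model, all fields PROVED:** ONE bad place `w`, Tate parameter `x ∈ F^*`
(at every place; only `w` is used), `[F:ℚ]`, `ord_v = ordLoc`, Mathlib uniformisers, «log v» `= log N(𝔭_v)`, and the normalisation
`log|x|_w = −ord_w(x)·log N(𝔭_w)` from `log_absLoc_inr`. [folklore] -/
def modelTateParamsZ (w : FinitePlace F) (x : F) (hx : x ≠ 0) : TateParamsZ (NumberFieldModel.model F) where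
  bad := {Sum.inr w}
  q := fun v => Units.mk0 (NumberFieldModel.toLoc F v x) (toLoc_ne_zero F v hx)
  degQ := Module.finrank ℚ F
  degQ_pos := Module.finrank_pos
  ordv := ordLoc F
  unif := unifLoc F
  logNv := logNLoc F
  ordv_unif := fun v hv => by
    rw [Finset.mem_singleton] at hv
    subst hv
    exact ordLoc_unifLoc_inr F w
  log_absLv_eq := fun v hv y => by
    rw [Finset.mem_singleton] at hv
    subst hv
    exact log_absLoc_inr F w y

/-- **Normalised reading at the model, BY NAME:** for every Kummer target, E-t27's `TateDegreeNonConstant` ([J-IV] Prop. 4.5.12 as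
printed, «log v» read in `arith(L)^nor_z`) FAILS on the model datum. Instance of `not_tateDegreeNonConstant_datumNor`; located, no
side. [claim: Joshi2024ATS4, status: disputed] -/
theorem model_not_tateDegreeNonConstant_datumNor [DecidableEq (NumberFieldModel.Place F)] (w : FinitePlace F) (x : F)
    (hx : x ≠ 0) (H : NumberFieldModel.Place F → Type) [∀ v, AddCommGroup (H v)] [∀ v, TopologicalSpace (H v)]
    (kum : ∀ v, (NumberFieldModel.Loc F v)ˣ →* Multiplicative (H v)) :
    ¬ ((modelTateParamsZ F w x hx).datumNor H kum).TateDegreeNonConstant :=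
  (modelTateParamsZ F w x hx).not_tateDegreeNonConstant_datumNor H kum

/-- **Raw reading at the model, BY NAME:** if `|x|_w ≠ 1` (so `ord_w(x) ≠ 0`), the RAW reading of `TateDegreeNonConstant` HOLDS —
witnessed by the arithmeticoids `y_0` and `y_1 = ϕ(y_0)` (`α_w = 1` resp. `p_w⁻¹`). Instance of `tateDegreeNonConstant_datumRaw_of`.
[claim: Joshi2024ATS4, status: disputed] -/
theorem model_tateDegreeNonConstant_datumRaw [DecidableEq (NumberFieldModel.Place F)] (w : FinitePlace F) (x : F)
    (hx : x ≠ 0) (hx1 : w x ≠ 1) (H : NumberFieldModel.Place F → Type) [∀ v, AddCommGroup (H v)]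
    [∀ v, TopologicalSpace (H v)] (kum : ∀ v, (NumberFieldModel.Loc F v)ˣ →* Multiplicative (H v)) :
    ((modelTateParamsZ F w x hx).datumRaw H kum).TateDegreeNonConstant := by
  have hval0 : w.maximalIdeal.valuation F x ≠ 0 := (Valuation.ne_zero_iff _).2 hx
  have hval1 : w.maximalIdeal.valuation F x ≠ 1 := by
    intro h1
    apply hx1
    rw [← NumberField.FinitePlace.norm_embedding_eq w x, NumberField.FinitePlace.norm_embedding', h1, map_one,
      NNReal.coe_one]
  have hord : (modelTateParamsZ F w x hx).ordv (Sum.inr w) ((modelTateParamsZ F w x hx).q (Sum.inr w)) ≠ 1 := by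
    intro h1
    have h2 := congrArg Multiplicative.toAdd h1
    rw [toAdd_one] at h2
    have h3 : Multiplicative.toAdd (ordLoc F (Sum.inr w)
        (Units.mk0 (NumberFieldModel.toLoc F (Sum.inr w) x) (toLoc_ne_zero F _ hx))) = 0 := h2
    rw [toAdd_ordLoc_inr, neg_eq_zero] at h3
    have h4 : w.maximalIdeal.valuation F x = WithZero.exp (0 : ℤ) := by
      rw [← WithZero.exp_log hval0]
      exact congrArg WithZero.exp h3
    exact hval1 (by rw [h4, WithZero.exp_zero])
  refine (modelTateParamsZ F w x hx).tateDegreeNonConstant_datumRaw_of H kum rfl hord (logNLoc_inr_ne_zero F w)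
    (z := fun _ => (0 : ℤ)) (z' := fun _ => (1 : ℤ)) ?_
  rw [model_alpha, model_alpha]
  show ((NumberFieldModel.resChar F (Sum.inr w) : ℝ) ^ (0 : ℤ))⁻¹ ≠
    ((NumberFieldModel.resChar F (Sum.inr w) : ℝ) ^ (1 : ℤ))⁻¹
  rw [zpow_zero, inv_one, zpow_one, ne_eq, eq_comm, inv_eq_one]
  exact_mod_cast (NumberFieldModel.resChar_prime F w).one_lt.ne'

/-- **Both horns of the located dichotomy for [J-IV] Prop. 4.5.12, BY NAME, at ONE datum of record** (any number field `F`, any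
finite place `w`; Mathlib supplies `x ∈ F^*` with `|x|_w ≠ 1`): the normalised reading of `TateDegreeNonConstant` fails and the raw
reading holds, for every Kummer target. A model exhibits satisfiability, nothing more; no side taken.
[claim: Joshi2024ATS4, status: disputed] -/
theorem model_prop4512_both_horns [DecidableEq (NumberFieldModel.Place F)] (w : FinitePlace F) :
    ∃ T : TateParamsZ (NumberFieldModel.model F),
      ∀ (H : NumberFieldModel.Place F → Type) [∀ v, AddCommGroup (H v)] [∀ v, TopologicalSpace (H v)]
        (kum : ∀ v, (NumberFieldModel.Loc F v)ˣ →* Multiplicative (H v)),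
        ¬ (T.datumNor H kum).TateDegreeNonConstant ∧ (T.datumRaw H kum).TateDegreeNonConstant := by
  obtain ⟨x, hx, h1⟩ := NumberFieldModel.exists_norm_toLoc_ne_one F (Sum.inr w)
  have hx1 : w x ≠ 1 := by
    rw [NumberFieldModel.norm_toLoc] at h1
    exact h1
  exact ⟨modelTateParamsZ F w x hx, fun H _ _ kum =>
    ⟨model_not_tateDegreeNonConstant_datumNor F w x hx H kum, model_tateDegreeNonConstant_datumRaw F w x hx hx1 H kum⟩⟩

end Model

end Summit.ABC.IUTFork.Joshi.ATS4
end
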